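import Summits.AtomisticToContinuum.HydrodynamicLimit.Theorems.AntiMazurCoboundariesCorrectorPressureDecayKiferUniformGibbsGlueCore
import Summits.AtomisticToContinuum.HydrodynamicLimit.Theorems.AntiMazurCoboundariesCorrectorPressureDecayKiferEntropyBoundGibbs
import Summits.AtomisticToContinuum.HydrodynamicLimit.Theorems.AntiMazurCoboundariesCorrectorPressureDecayKiferWindowLscTangent

/-!
# The Gibbs route to the uniform entropy bound, III: the glue (line `FirstLemma`, crux stmt-AtomisticToContinuum-14135
# `AntiMazurCoboundaries.CorrectorPressureDecay`)

Registered stub `tangentEntropyBoundUniformGibbs_of_pieces` of line `FirstLemma` (lead seat c9), namespace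
`Summit.AtomisticToContinuum.HydrodynamicLimit.Theorems.KiferCompactification`:

  `CanonicalCellInequality → CanonicalBlockFreeEntropy → TangentEntropyBoundUniformGibbs`

(…KiferUniformGibbsPieces.lean for the two pieces, …KiferEntropyBoundGibbs.lean for the target): the unit-weight tangent-state entropy bound
`h(μ | G) ≤ σ³ · liminf_k (N(ι k)+1)⁻¹ KL(Q(ι k) ‖ G_{N(ι k)})` with CONSTANT `1`, for a translation-invariant DLR reference `G ∈ Gibbs(z)` of
density `σ³`, below `σ₂ = 1/8` (then `σ ≤ 1/2` and `z ≤ 2σ³ ≤ 1/64` by the activity bound `stub_activityBound`).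

Proof (`μ_Λ = windowLaw Λ μ`, `Λ_n = centredBox n = [-(n+1), n+1)³`, `U_n = (-(n+2), n+2)³`, `L = 2n + 5`, `ε_k = hsDiameter σ (N (ι k))`,
`m_k = ⌊ε_k⁻¹ / L⌋₊`, `u_k = (N(ι k)+1)⁻¹ KL(Q(ι k) ‖ G_{N(ι k)}) ∈ [0, κ]`, `ℓ = liminf u`):
* (A) `KL(μ_{Λ_n} ‖ G_{Λ_n}) ≤ KL(μ_{U_n} ‖ G_{U_n})` (data processing, `klDiv_windowLaw_mono`);
* (B) `KL(μ_{U_n} ‖ G_{U_n}) ≤ liminf_k KL((P_k)_{U_n} ‖ G_{U_n})`, `P_k = blowUpLaw σ 1 (N (ι k)) (Q (ι k))` — window lower semicontinuity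
  along the tangent state against the FIXED reference `G_{U_n}` (`c9_klDiv_windowLaw_tangent_le_liminf`; `Q` is carried by the hard-sphere
  domain by finiteness of its entropy);
* (C)–(E) the fixed-size estimate `c9_integral_klDiv_window_le_of_cellInequality` (…KiferUniformGibbsGlueCore.lean) with `m_k ≥ 7` cells for
  `k` large: `KL((P_k)_{U_n} ‖ G_{U_n}) ≤ (KL(Q ‖ G_N) + c_N(m_k))/m_k³ + 26 z (ε_k⁻¹/m_k)²` (unit collars of the cells,
  `volume_thickening_c9Cell_diff_le`);
* (F) `KL(Q ‖ G_N)/m_k³ = σ³ (ε_k⁻¹/m_k)³ u_k` by `(N+1) ε_N³ = σ³`, `c_N(m_k)/m_k³ ≤ δ L³` eventually by the thermodynamic step (B) = `hB`,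
  `L ≤ ε_k⁻¹/m_k ≤ L (1 + 1/m_k)` so `(ε_k⁻¹/m_k)³ ≤ L³ + δ` for `k` large; the monotone continuous map `s ↦ ofReal((L³+δ)σ³ s + D)` commutes
  with `liminf` (`Monotone.map_liminf_of_continuousAt`): `KL(μ_{Λ_n} ‖ G_{Λ_n}) ≤ (L³ + δ) σ³ ℓ + δ L³ + 104 z L²`
  (`klDiv_windowLaw_centredBox_le_of_pieces`);
* (G) divide by `vol Λ_n = (2n+2)³` (`volume_centredBox_fin3`); the ratio is a polynomial in `1/(n+1)` tending to `σ³ ℓ + δ`, so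
  `h(μ | G) = limsup_n KL(μ_{Λ_n} ‖ G_{Λ_n}) / vol Λ_n ≤ σ³ ℓ + 2δ` for every `δ > 0`.

The setwise local-convergence hypothesis of `TangentEntropyBoundUniformGibbs` is not used (only the Gibbs property, translation invariance and
density of `G`). No new definitions. References: S. Olla, S. R. S. Varadhan, H.-T. Yau, Comm. Math. Phys. 155 (1993) Lemma 4.2, §5;
H.-O. Georgii, J. Stat. Phys. 80 (1995) §3; C. Kipnis, C. Landim, *Scaling Limits of Interacting Particle Systems* (1999) App. 1 §8.
-/

noncomputable section

open MeasureTheory ProbabilityTheory Set Filter Topology InformationTheory Metric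
open scoped ENNReal NNReal

namespace Summit.AtomisticToContinuum.HydrodynamicLimit.Theorems.KiferCompactification

open Literature.MathematicalPhysics.KineticTheory (T3 V3 hsDiameter hsDiameter_pos localGibbsLaw blowUpPoint blowUp
  succ_mul_hsDiameter_pow_three)
open Literature.MathematicalPhysics.KineticTheory.PointProcess (windowLaw windowRestrict centredBox measurable_windowRestrict
  isProbabilityMeasure_windowLaw specificRelEntropy)
open Literature.Analysis.FluidPDE (HardSphereFlow Config IsHardSphereGibbs IsTranslationInvariant)
open Literature.Analysis.FunctionSpaces (PointConfig)
open Literature.Analysis.FunctionSpaces.Torus (proj)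

/-! ## Volumes: cubes, cells, unit collars -/

/-- The volume of an open coordinate cube of side `w`. -/
theorem volume_setOf_forall_apply_mem_Ioo {lo hi : Fin 3 → ℝ} {w : ℝ} (hw : ∀ i, hi i - lo i = w) (hw0 : 0 ≤ w) :
    volume {y : V3 | ∀ i, y i ∈ Ioo (lo i) (hi i)} = ENNReal.ofReal (w ^ 3) := by
  rw [setOf_forall_apply_mem_Ioo_eq, (PiLp.volume_preserving_ofLp (Fin 3)).measure_preimage
    (MeasurableSet.univ_pi fun i => measurableSet_Ioo).nullMeasurableSet, Real.volume_pi_Ioo]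
  simp only [hw, Finset.prod_const, Finset.card_univ, Fintype.card_fin, ENNReal.ofReal_pow hw0]

/-- The volume of a cell of the cube of side `S` cut into `m³` cells is `(S/m)³`. -/
theorem volume_c9Cell {S : ℝ} (hS : 0 ≤ S) (m : ℕ) (j : Fin 3 → Fin m) :
    volume (c9Cell S m j) = ENNReal.ofReal ((S / m) ^ 3) := by
  have h : c9Cell S m j = (WithLp.ofLp : V3 → Fin 3 → ℝ) ⁻¹' Set.pi univ fun i =>
      Ioc (-S / 2 + ((j i : ℕ) : ℝ) * (S / m)) (-S / 2 + (((j i : ℕ) : ℝ) + 1) * (S / m)) := by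
    ext y; simp [c9Cell]
  rw [h, (PiLp.volume_preserving_ofLp (Fin 3)).measure_preimage
    (MeasurableSet.univ_pi fun i => measurableSet_Ioc).nullMeasurableSet, Real.volume_pi_Ioc]
  have hw : ∀ i, -S / 2 + (((j i : ℕ) : ℝ) + 1) * (S / m) - (-S / 2 + ((j i : ℕ) : ℝ) * (S / m)) = S / m := fun i => by ring
  simp only [hw, Finset.prod_const, Finset.card_univ, Fintype.card_fin, ENNReal.ofReal_pow (div_nonneg hS (Nat.cast_nonneg _))]

/-- A coordinate is `1`-Lipschitz: `|y i - x i| ≤ dist y x` in `ℝ³`. -/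
theorem abs_apply_sub_apply_le_dist (y x : V3) (i : Fin 3) : |y i - x i| ≤ dist y x := by
  rw [dist_eq_norm, ← PiLp.sub_apply, ← Real.norm_eq_abs]
  exact PiLp.norm_apply_le (y - x) i

/-- **The unit thickening of a set inside a closed coordinate box lies in the box enlarged by one.** -/
theorem thickening_one_subset_of_subset_Icc {B : Set V3} {lo hi : Fin 3 → ℝ} (hB : ∀ y ∈ B, ∀ i, y i ∈ Icc (lo i) (hi i)) :
    thickening 1 B ⊆ {y : V3 | ∀ i, y i ∈ Ioo (lo i - 1) (hi i + 1)} := by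
  intro y hy i
  obtain ⟨x, hx, hxy⟩ := mem_thickening_iff.1 hy
  have h := abs_apply_sub_apply_le_dist y x i
  rw [abs_le] at h
  obtain ⟨h1, h2⟩ := hB x hx i
  constructor <;> linarith

/-- **The unit collar of a cell has volume `≤ 26 (S/m)²`** once the cell side `S/m` is at least `1`:
`vol((thickening 1 cell) \ cell) ≤ (S/m + 2)³ - (S/m)³ = 6(S/m)² + 12(S/m) + 8`. -/
theorem volume_thickening_c9Cell_diff_le {S : ℝ} (hS : 0 ≤ S) {m : ℕ} (hL : 1 ≤ S / m) (j : Fin 3 → Fin m) :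
    volume (thickening 1 (c9Cell S m j) \ c9Cell S m j) ≤ ENNReal.ofReal (26 * (S / m) ^ 2) := by
  set B' : Set V3 := {y | ∀ i, y i ∈ Ioo (-S / 2 + ((j i : ℕ) : ℝ) * (S / m) - 1) (-S / 2 + (((j i : ℕ) : ℝ) + 1) * (S / m) + 1)}
  have hsub : thickening 1 (c9Cell S m j) ⊆ B' :=
    thickening_one_subset_of_subset_Icc (lo := fun i => -S / 2 + ((j i : ℕ) : ℝ) * (S / m))
      (hi := fun i => -S / 2 + (((j i : ℕ) : ℝ) + 1) * (S / m)) fun y hy i => Ioc_subset_Icc_self (hy i)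
  have hcell : c9Cell S m j ⊆ B' := (self_subset_thickening one_pos _).trans hsub
  have hB' : volume B' = ENNReal.ofReal ((S / m + 2) ^ 3) :=
    volume_setOf_forall_apply_mem_Ioo (fun i => by ring) (by linarith)
  calc volume (thickening 1 (c9Cell S m j) \ c9Cell S m j) ≤ volume (B' \ c9Cell S m j) :=
        measure_mono (sdiff_subset_sdiff_left hsub)
    _ = ENNReal.ofReal ((S / m + 2) ^ 3) - ENNReal.ofReal ((S / m) ^ 3) := by
        rw [measure_sdiff hcell (measurableSet_c9Cell S m j).nullMeasurableSet
          (by rw [volume_c9Cell hS]; exact ENNReal.ofReal_ne_top), hB', volume_c9Cell hS]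
    _ = ENNReal.ofReal ((S / m + 2) ^ 3 - (S / m) ^ 3) := (ENNReal.ofReal_sub _ (by positivity)).symm
    _ ≤ ENNReal.ofReal (26 * (S / m) ^ 2) := ENNReal.ofReal_le_ofReal (by nlinarith)

/-! ## The centred cubes and the open cubes `U_n` -/

/-- The centred cube `Λ_n = [-(n+1), n+1)³` has volume `(2(n+1))³`. -/
theorem volume_centredBox_fin3 (n : ℕ) : volume (centredBox (d := Fin 3) n) = ENNReal.ofReal ((2 * ((n : ℝ) + 1)) ^ 3) := by
  have h : centredBox (d := Fin 3) n =
      (WithLp.ofLp : V3 → Fin 3 → ℝ) ⁻¹' Set.pi univ fun _ => Ico (-((n : ℝ) + 1)) ((n : ℝ) + 1) := by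
    ext y; simp [centredBox]
  rw [h, (PiLp.volume_preserving_ofLp (Fin 3)).measure_preimage
    (MeasurableSet.univ_pi fun i => measurableSet_Ico).nullMeasurableSet, Real.volume_pi_Ico]
  have hw : (n : ℝ) + 1 - -((n : ℝ) + 1) = 2 * ((n : ℝ) + 1) := by ring
  simp only [hw, Finset.prod_const, Finset.card_univ, Fintype.card_fin, ENNReal.ofReal_pow (by positivity : (0 : ℝ) ≤ 2 * ((n : ℝ) + 1))]

/-- `Λ_n ⊆ U_n = (-(n+2), n+2)³`. -/
theorem centredBox_subset_setOf_Ioo (n : ℕ) :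
    centredBox (d := Fin 3) n ⊆ {y : V3 | ∀ i, y i ∈ Ioo (-((n : ℝ) + 2)) ((n : ℝ) + 2)} :=
  fun y hy i => ⟨by linarith [(hy i).1], by linarith [(hy i).2]⟩

/-! ## Step (F): the entropy of a centred cube along the tangent family -/

/-- **THE WINDOW BOUND ALONG THE TANGENT FAMILY** (steps (A), (B), (F) of the Gibbs route). For a unit-weight tangent state `μ` of a
tangent family with budget `κ`, a translation-invariant `G ∈ Gibbs(z)`, a window index `n` with cell-size target `L = 2n + 5`, and
`δ > 0` such that eventually along the family the block constant with `⌊ε⁻¹/L⌋₊` cells per side is `≤ ⌊ε⁻¹/L⌋₊³ δ L³` (the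
thermodynamic step (B)): `KL(μ_{Λ_n} ‖ G_{Λ_n}) ≤ ((L³ + δ) σ³ ℓ + δ L³ + 104 z L²)` with `ℓ = liminf_k (N(ι k)+1)⁻¹ KL(Q(ι k) ‖ G_{N(ι k)})`.
Proof: `Λ_n ⊆ U_n` (data processing), window lower semicontinuity against the fixed reference `G_{U_n}`
(`c9_klDiv_windowLaw_tangent_le_liminf`), the fixed-size estimate `c9_integral_klDiv_window_le_of_cellInequality` for all large `k`
with `m_k = ⌊ε_k⁻¹/L⌋₊ → ∞` cells (`KL(Q ‖ G_N)/m_k³ = σ³ (ε_k⁻¹/m_k)³ u_k` by `(N+1) ε_N³ = σ³`, and `ε_k⁻¹/m_k ↓ L`), and the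
monotone continuous map `s ↦ ofReal((L³+δ)σ³ s + D)` commutes with `liminf`. -/
theorem klDiv_windowLaw_centredBox_le_of_pieces (hcell : CanonicalCellInequality) {σ a θ z κ δ : ℝ} {u₀ : V3}
    (hσ : 0 < σ) (hσ2 : σ ≤ 1 / 2) (ha : 0 < a) (hθ : 0 < θ) (hz : 0 < z) (hκ : 0 < κ) (hδ : 0 < δ) {N : ℕ → ℕ}
    {Φ : ∀ k, HardSphereFlow (Literature.Analysis.FluidPDE.Torus.geometry (Fin 3)) (hsDiameter σ (N k)) (N k + 1)}
    {Q : ∀ k, Measure (Config (N k + 1) (Fin 3) T3)} (hfam : IsTangentFamily σ a θ u₀ κ N Φ Q) {ι : ℕ → ℕ}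
    {μ : Measure (PointConfig (V3 × V3))} [IsProbabilityMeasure μ] (hμ : IsTangentState σ (fun _ => (1 : ℝ)) N Q ι μ)
    {G : Measure (PointConfig (V3 × V3))} (hG : IsHardSphereGibbs 1 z θ⁻¹ u₀ G) (hGT : IsTranslationInvariant G) (n : ℕ)
    (hBev : ∀ᶠ k in atTop, canonicalBlockConst σ a θ u₀ z (N (ι k)) (Φ (ι k)) ⌊(hsDiameter σ (N (ι k)))⁻¹ / (2 * (n : ℝ) + 5)⌋₊ ≤
      ENNReal.ofReal (((⌊(hsDiameter σ (N (ι k)))⁻¹ / (2 * (n : ℝ) + 5)⌋₊ : ℕ) : ℝ) ^ 3 * δ * (2 * (n : ℝ) + 5) ^ 3)) :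
    klDiv (windowLaw (centredBox n) μ) (windowLaw (centredBox n) G) ≤
      ENNReal.ofReal (((2 * (n : ℝ) + 5) ^ 3 + δ) * (σ ^ 3 * liminf (fun k => ((N (ι k) + 1 : ℕ) : ℝ)⁻¹ *
          (klDiv (Q (ι k)) (localGibbsLaw σ (fun _ => a) (fun _ => u₀) (fun _ => θ) (N (ι k)) (Φ (ι k)))).toReal) atTop) +
        (δ * (2 * (n : ℝ) + 5) ^ 3 + z * (104 * (2 * (n : ℝ) + 5) ^ 2))) := by
  haveI := hG.1
  haveI : ∀ k, IsProbabilityMeasure (Q k) := hfam.2.1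
  have hβ : 0 < θ⁻¹ := inv_pos.2 hθ
  set L : ℝ := 2 * (n : ℝ) + 5 with hL
  have hn0 : (0 : ℝ) ≤ n := n.cast_nonneg
  have hL1 : 1 ≤ L := by linarith
  have hL0 : 0 < L := by linarith
  set U : Set V3 := {y | ∀ i, y i ∈ Ioo (-((n : ℝ) + 2)) ((n : ℝ) + 2)} with hU
  have hUo : IsOpen U := isOpen_setOf_forall_apply_mem_Ioo (fun _ => -((n : ℝ) + 2)) fun _ => (n : ℝ) + 2
  have hUb : Bornology.IsBounded U := isBounded_setOf_forall_apply_mem_Ioo (fun _ => -((n : ℝ) + 2)) fun _ => (n : ℝ) + 2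
  haveI := isProbabilityMeasure_windowLaw (M := V3) hUo.measurableSet G
  -- the entropy sequence `u ∈ [0, κ]`
  set u : ℕ → ℝ := fun k => ((N (ι k) + 1 : ℕ) : ℝ)⁻¹ *
      (klDiv (Q (ι k)) (localGibbsLaw σ (fun _ => a) (fun _ => u₀) (fun _ => θ) (N (ι k)) (Φ (ι k)))).toReal with hu
  have hKL : ∀ k, klDiv (Q k) (localGibbsLaw σ (fun _ => a) (fun _ => u₀) (fun _ => θ) (N k) (Φ k)) ≠ ⊤ := fun k =>
    ne_top_of_le_ne_top ENNReal.ofReal_ne_top (hfam.2.2.1 k)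
  have hu0 : ∀ k, 0 ≤ u k := fun k => mul_nonneg (inv_nonneg.2 (Nat.cast_nonneg _)) ENNReal.toReal_nonneg
  have huκ : ∀ k, u k ≤ κ := fun k => by
    have h1 : (klDiv (Q (ι k)) (localGibbsLaw σ (fun _ => a) (fun _ => u₀) (fun _ => θ) (N (ι k)) (Φ (ι k)))).toReal ≤
        κ * (N (ι k) + 1) := by
      have h := ENNReal.toReal_mono ENNReal.ofReal_ne_top (hfam.2.2.1 (ι k))
      rwa [ENNReal.toReal_ofReal (by positivity)] at h
    have hn : (0 : ℝ) < ((N (ι k) + 1 : ℕ) : ℝ) := by positivity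
    rw [hu]
    simp only
    rw [inv_mul_le_iff₀ hn]
    calc _ ≤ κ * (N (ι k) + 1) := h1
      _ = ((N (ι k) + 1 : ℕ) : ℝ) * κ := by push_cast; ring
  -- steps (A), (B): the cube `Λ_n` inside the open cube `U`, lower semicontinuity against the FIXED reference `G_U`
  have hQdom : ∀ k, ∀ᵐ w ∂Q k, w ∈ Literature.Analysis.FluidPDE.hardSphereDomain (Literature.Analysis.FluidPDE.Torus.geometry (Fin 3))
      (N k + 1) (hsDiameter σ (N k)) := fun k => ae_mem_hardSphereDomain_of_klDiv_ne_top (hKL k)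
  have hA : klDiv (windowLaw (centredBox n) μ) (windowLaw (centredBox n) G) ≤
      liminf (fun k => klDiv (windowLaw U (blowUpLaw σ (fun _ => (1 : ℝ)) (N (ι k)) (Q (ι k)))) (windowLaw U G)) atTop :=
    (klDiv_windowLaw_mono (measurableSet_centredBox_fin3 n) hUo.measurableSet (centredBox_subset_setOf_Ioo n) μ G).trans
      (c9_klDiv_windowLaw_tangent_le_liminf hσ hQdom hμ hUo hUb (windowLaw U G))
  -- sizes tend to infinity
  have hN : Tendsto (fun k => N (ι k)) atTop atTop :=
    tendsto_atTop_mono (fun k => (hμ.1.id_le k).trans (hfam.1 _)) tendsto_id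
  have hSk : Tendsto (fun k => (hsDiameter σ (N (ι k)))⁻¹) atTop atTop :=
    tendsto_inv_nhdsGT_zero.comp (tendsto_nhdsWithin_iff.2
      ⟨tendsto_hsDiameter_of_tendsto hN, Eventually.of_forall fun k => hsDiameter_pos hσ _⟩)
  have hq : ∀ᶠ k in atTop, 8 + 4 * L ^ 3 / δ ≤ (hsDiameter σ (N (ι k)))⁻¹ / L :=
    (hSk.atTop_div_const hL0).eventually_ge_atTop _
  -- steps (C)–(E) at fixed `k` (the Core estimate) and the arithmetic of the cells
  set D : ℝ := δ * L ^ 3 + z * (104 * L ^ 2) with hD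
  have hD0 : 0 ≤ D := by positivity
  have hev : ∀ᶠ k in atTop, klDiv (windowLaw U (blowUpLaw σ (fun _ => (1 : ℝ)) (N (ι k)) (Q (ι k)))) (windowLaw U G) ≤
      ENNReal.ofReal ((L ^ 3 + δ) * (σ ^ 3 * u k) + D) := by
    filter_upwards [hq, hBev] with k hqk hBk
    set ε := hsDiameter σ (N (ι k)) with hε'
    have hε : 0 < ε := hsDiameter_pos hσ _
    have hLδ : 0 ≤ 4 * L ^ 3 / δ := by positivity
    set m : ℕ := ⌊ε⁻¹ / L⌋₊ with hm'
    have hm_le : (m : ℝ) ≤ ε⁻¹ / L := Nat.floor_le (by positivity)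
    have hm_gt : ε⁻¹ / L < m + 1 := Nat.lt_floor_add_one _
    have hm7 : 7 ≤ m := Nat.le_floor (by push_cast; linarith)
    have hm0 : 0 < m := by omega
    have hm0' : (0 : ℝ) < m := Nat.cast_pos.2 hm0
    have hmδ : 4 * L ^ 3 / δ ≤ m := by linarith
    -- the cell side `t = ε⁻¹ / m ∈ [L, L (1 + 1/m)]`
    set t : ℝ := ε⁻¹ / m with ht'
    have ht0 : 0 ≤ t := by positivity
    have htL : L ≤ t := by
      rw [ht', le_div_iff₀ hm0']
      have h := (le_div_iff₀ hL0).1 hm_le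
      linarith
    have htU : t ≤ L * (1 + 1 / m) := by
      rw [ht', div_le_iff₀ hm0']
      have h := ((div_lt_iff₀ hL0).1 hm_gt).le
      calc ε⁻¹ ≤ (m + 1) * L := h
        _ = L * (1 + 1 / m) * m := by field_simp
    have hfit : 2 * ((n : ℝ) + 2) ≤ ε⁻¹ / m := by linarith
    have hx : (1 : ℝ) / m ≤ 1 / 7 := one_div_le_one_div_of_le (by norm_num) (by exact_mod_cast hm7)
    have hx0 : (0 : ℝ) ≤ 1 / m := by positivity
    have ht3 : t ^ 3 ≤ L ^ 3 + δ := by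
      have hxx : 1 / (m : ℝ) * (1 / m) ≤ 1 / 7 * (1 / m) := mul_le_mul_of_nonneg_right hx hx0
      have hxxx : 1 / (m : ℝ) * (1 / m) * (1 / m) ≤ 1 / 7 * (1 / m) * (1 / m) := mul_le_mul_of_nonneg_right hxx hx0
      have h2 : (1 + 1 / (m : ℝ)) ^ 3 ≤ 1 + 4 * (1 / m) := by
        have h := show (1 + 1 / (m : ℝ)) ^ 3 = 1 + 3 * (1 / m) + 3 * (1 / (m : ℝ) * (1 / m)) + 1 / (m : ℝ) * (1 / m) * (1 / m) by ring
        rw [h]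
        linarith
      have h3 : 4 * L ^ 3 * (1 / (m : ℝ)) ≤ δ := by
        rw [div_le_iff₀ hδ] at hmδ
        rw [← mul_div_assoc, mul_one, div_le_iff₀ hm0']
        linarith
      calc t ^ 3 ≤ (L * (1 + 1 / m)) ^ 3 := pow_le_pow_left₀ ht0 htU 3
        _ = L ^ 3 * (1 + 1 / m) ^ 3 := mul_pow _ _ _
        _ ≤ L ^ 3 * (1 + 4 * (1 / m)) := mul_le_mul_of_nonneg_left h2 (by positivity)
        _ = L ^ 3 + 4 * L ^ 3 * (1 / m) := by ring
        _ ≤ L ^ 3 + δ := by linarith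
    have ht2 : z * (26 * t ^ 2) ≤ z * (104 * L ^ 2) := by
      refine mul_le_mul_of_nonneg_left ?_ hz.le
      have h1 : t ≤ 2 * L :=
        htU.trans ((mul_le_mul_of_nonneg_left (by linarith : 1 + 1 / (m : ℝ) ≤ 2) hL0.le).trans_eq (mul_comm _ _))
      nlinarith
    -- the Core estimate and the identity `KL(Q ‖ G_N) / m³ = σ³ t³ u`
    have hm3 : (m : ℝ≥0∞) ^ 3 = ENNReal.ofReal ((m : ℝ) ^ 3) := by
      rw [ENNReal.ofReal_pow (Nat.cast_nonneg _), ENNReal.ofReal_natCast]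
    have hm3ne0 : (m : ℝ≥0∞) ^ 3 ≠ 0 := pow_ne_zero 3 (Nat.cast_ne_zero.2 hm0.ne')
    have hm3netop : (m : ℝ≥0∞) ^ 3 ≠ ⊤ := ENNReal.pow_ne_top ENNReal.coe_ne_top
    have hKLk : klDiv (Q (ι k)) (localGibbsLaw σ (fun _ => a) (fun _ => u₀) (fun _ => θ) (N (ι k)) (Φ (ι k))) ≤
        ENNReal.ofReal (σ ^ 3 * t ^ 3 * u k) * (m : ℝ≥0∞) ^ 3 := by
      rw [hm3, ← ENNReal.ofReal_mul (mul_nonneg (by positivity) (hu0 k))]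
      have hNS : ((N (ι k) + 1 : ℕ) : ℝ) * ε ^ 3 = σ ^ 3 := succ_mul_hsDiameter_pow_three σ (N (ι k))
      have hN0 : (0 : ℝ) < ((N (ι k) + 1 : ℕ) : ℝ) := by positivity
      have h : σ ^ 3 * t ^ 3 * u k * (m : ℝ) ^ 3 =
          (klDiv (Q (ι k)) (localGibbsLaw σ (fun _ => a) (fun _ => u₀) (fun _ => θ) (N (ι k)) (Φ (ι k)))).toReal := by
        rw [hu, ht', ← hNS]
        field_simp
      rw [h, ENNReal.ofReal_toReal (hKL (ι k))]
    have hcbc : canonicalBlockConst σ a θ u₀ z (N (ι k)) (Φ (ι k)) m ≤ ENNReal.ofReal (δ * L ^ 3) * (m : ℝ≥0∞) ^ 3 := by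
      rw [hm3, ← ENNReal.ofReal_mul (by positivity)]
      refine hBk.trans (le_of_eq ?_)
      congr 1
      ring
    have hL'1 : 1 ≤ ε⁻¹ / m := hL1.trans htL
    refine (c9_integral_klDiv_window_le_of_cellInequality hcell hσ hσ2 ha hθ hz (N (ι k)) (Φ (ι k)) (Q (ι k)) hG hGT
      hm7 hfit (by positivity : (0 : ℝ) ≤ 26 * (ε⁻¹ / m) ^ 2)
      (fun j => volume_thickening_c9Cell_diff_le (inv_pos.2 hε).le hL'1 j)).trans ?_
    calc (klDiv (Q (ι k)) (localGibbsLaw σ (fun _ => a) (fun _ => u₀) (fun _ => θ) (N (ι k)) (Φ (ι k))) +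
          canonicalBlockConst σ a θ u₀ z (N (ι k)) (Φ (ι k)) m) / (m : ℝ≥0∞) ^ 3 + ENNReal.ofReal (z * (26 * (ε⁻¹ / m) ^ 2))
        ≤ (ENNReal.ofReal (σ ^ 3 * t ^ 3 * u k) * (m : ℝ≥0∞) ^ 3 + ENNReal.ofReal (δ * L ^ 3) * (m : ℝ≥0∞) ^ 3) /
            (m : ℝ≥0∞) ^ 3 + ENNReal.ofReal (z * (104 * L ^ 2)) :=
          add_le_add (ENNReal.div_le_div_right (add_le_add hKLk hcbc) _) (ENNReal.ofReal_le_ofReal ht2)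
      _ = ENNReal.ofReal (σ ^ 3 * t ^ 3 * u k) + ENNReal.ofReal (δ * L ^ 3) + ENNReal.ofReal (z * (104 * L ^ 2)) := by
          rw [← add_mul, ENNReal.mul_div_cancel_right hm3ne0 hm3netop]
      _ = ENNReal.ofReal (σ ^ 3 * t ^ 3 * u k + δ * L ^ 3 + z * (104 * L ^ 2)) := by
          rw [ENNReal.ofReal_add (by positivity) (by positivity), ENNReal.ofReal_add (mul_nonneg (by positivity) (hu0 k)) (by positivity)]
      _ ≤ ENNReal.ofReal ((L ^ 3 + δ) * (σ ^ 3 * u k) + D) := by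
          refine ENNReal.ofReal_le_ofReal ?_
          have h := mul_le_mul_of_nonneg_right ht3 (mul_nonneg (by positivity) (hu0 k) : 0 ≤ σ ^ 3 * u k)
          rw [hD]
          nlinarith
  -- step (F): pass to the `liminf` through the monotone continuous map `s ↦ ofReal ((L³+δ) σ³ s + D)`
  have hgm : Monotone fun s : ℝ => ENNReal.ofReal ((L ^ 3 + δ) * (σ ^ 3 * s) + D) := fun s s' hss' =>
    ENNReal.ofReal_le_ofReal (by nlinarith [mul_nonneg (by positivity : (0 : ℝ) ≤ L ^ 3 + δ) (by positivity : (0 : ℝ) ≤ σ ^ 3)])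
  have hgc : Continuous fun s : ℝ => ENNReal.ofReal ((L ^ 3 + δ) * (σ ^ 3 * s) + D) := ENNReal.continuous_ofReal.comp (by fun_prop)
  have hcobdd : IsCoboundedUnder (· ≥ ·) atTop u := (isBoundedUnder_of ⟨κ, huκ⟩).isCoboundedUnder_ge
  have hbdd : IsBoundedUnder (· ≥ ·) atTop u := isBoundedUnder_of ⟨0, hu0⟩
  have hlim : ENNReal.ofReal ((L ^ 3 + δ) * (σ ^ 3 * liminf u atTop) + D) =
      liminf (fun k => ENNReal.ofReal ((L ^ 3 + δ) * (σ ^ 3 * u k) + D)) atTop :=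
    hgm.map_liminf_of_continuousAt u hgc.continuousAt hcobdd hbdd
  exact hA.trans ((liminf_le_liminf hev).trans hlim.symm.le)

/-! ## The registered stub: the glue of the Gibbs route -/

/-- **THE UNIT-WEIGHT ENTROPY BOUND WITH A GIBBS REFERENCE FROM THE TWO PIECES OF THE GIBBS ROUTE** (registered stub
`tangentEntropyBoundUniformGibbs_of_pieces` of line `FirstLemma`, crux stmt-AtomisticToContinuum-14135): the finite-`N` cell inequality
`CanonicalCellInequality` and the thermodynamic step `CanonicalBlockFreeEntropy` imply `TangentEntropyBoundUniformGibbs` with `σ₂ = 1/8`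
(so that `σ ≤ 1/2` and, by the activity bound `stub_activityBound`, `z ≤ 2σ³ ≤ 1/64`). By `klDiv_windowLaw_centredBox_le_of_pieces`,
for every `δ > 0` and all large `n`, `KL(μ_{Λ_n} ‖ G_{Λ_n}) ≤ ((2n+5)³ + δ) σ³ ℓ + δ (2n+5)³ + 104 z (2n+5)²`; dividing by
`vol Λ_n = (2n+2)³` and letting `n → ∞` gives `h(μ | G) ≤ σ³ ℓ + δ` for every `δ > 0`. The local-convergence hypothesis is not used. -/
theorem tangentEntropyBoundUniformGibbs_of_pieces (hcell : CanonicalCellInequality) (hB : CanonicalBlockFreeEntropy) :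
    TangentEntropyBoundUniformGibbs := by
  refine ⟨1 / 8, by norm_num, ?_⟩
  intro σ a θ u₀ κ hσ hσ8 ha hθ hκ N Φ Q hfam ι μ hμ hμP hμT G hGP hGT z hz hG hGd _hloc
  have hσ2 : σ ≤ 1 / 2 := by linarith
  have hσ3 : σ ^ 3 ≤ 1 / 128 := by
    have h3 : σ ^ 3 ≤ (1 / 8) * (1 / 8) * (1 / 8) := by
      calc σ ^ 3 = σ * σ * σ := by ring
        _ ≤ (1 / 8) * (1 / 8) * (1 / 8) := by gcongr
    linarith
  have hz64 : z ≤ 1 / 64 := by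
    have h := stub_activityBound z θ u₀ G (σ ^ 3) hz hθ hG hGT hGd (by positivity) hσ3
    linarith
  haveI : ∀ k, IsProbabilityMeasure (Q k) := hfam.2.1
  set u : ℕ → ℝ := fun k => ((N (ι k) + 1 : ℕ) : ℝ)⁻¹ *
      (klDiv (Q (ι k)) (localGibbsLaw σ (fun _ => a) (fun _ => u₀) (fun _ => θ) (N (ι k)) (Φ (ι k)))).toReal with hu
  set ℓ : ℝ := liminf u atTop with hℓ
  have hN : Tendsto (fun k => N (ι k)) atTop atTop :=
    tendsto_atTop_mono (fun k => (hμ.1.id_le k).trans (hfam.1 _)) tendsto_id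
  -- step (F) for every `δ > 0`, for all large windows
  have hF : ∀ δ : ℝ, 0 < δ → ∀ᶠ n : ℕ in atTop, klDiv (windowLaw (centredBox n) μ) (windowLaw (centredBox n) G) ≤
      ENNReal.ofReal (((2 * (n : ℝ) + 5) ^ 3 + δ) * (σ ^ 3 * ℓ) + (δ * (2 * (n : ℝ) + 5) ^ 3 + z * (104 * (2 * (n : ℝ) + 5) ^ 2))) := by
    intro δ hδ
    obtain ⟨L₀, -, hBL⟩ := hB σ a θ u₀ z hσ hσ2 ha hθ hz hz64 ⟨G, hG, hGT, hGd⟩ δ hδ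
    have hLn : Tendsto (fun n : ℕ => 2 * (n : ℝ) + 5) atTop atTop :=
      tendsto_atTop_add_const_right _ _ (tendsto_natCast_atTop_atTop.const_mul_atTop two_pos)
    filter_upwards [hLn.eventually_ge_atTop L₀] with n hn
    exact klDiv_windowLaw_centredBox_le_of_pieces hcell hσ hσ2 ha hθ hz hκ hδ hfam hμ hG hGT n
      (hBL _ hn (fun k => N (ι k)) (fun k => Φ (ι k)) hN)
  -- step (G): divide by `vol Λ_n = (2n+2)³` and let `n → ∞`
  change limsup (fun n : ℕ => klDiv (windowLaw (centredBox n) μ) (windowLaw (centredBox n) G) / volume (centredBox (d := Fin 3) n))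
    atTop ≤ ENNReal.ofReal (σ ^ 3 * ℓ)
  refine ENNReal.le_of_forall_pos_le_add fun η hη _ => ?_
  have hη : (0 : ℝ) < η := by exact_mod_cast hη
  have hδ : (0 : ℝ) < η / 2 := by positivity
  -- the real ratio is a polynomial in `t = 1/(n+1)` and tends to `σ³ ℓ + η/2 < σ³ ℓ + η`
  set P : ℝ → ℝ := fun t => (1 + 3 / 2 * t) ^ 3 * (σ ^ 3 * ℓ) + η / 2 * (σ ^ 3 * ℓ) * t ^ 3 / 8 +
    η / 2 * (1 + 3 / 2 * t) ^ 3 + z * 104 * (1 + 3 / 2 * t) ^ 2 * t / 2 with hP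
  have hPc : Continuous P := by rw [hP]; fun_prop
  have hP0 : P 0 = σ ^ 3 * ℓ + η / 2 := by rw [hP]; ring
  have hPt : Tendsto (fun n : ℕ => P (1 / ((n : ℝ) + 1))) atTop (𝓝 (σ ^ 3 * ℓ + η / 2)) := by
    rw [← hP0]
    exact (hPc.tendsto 0).comp tendsto_one_div_add_atTop_nhds_zero_nat
  have hPn : ∀ n : ℕ, (((2 * (n : ℝ) + 5) ^ 3 + η / 2) * (σ ^ 3 * ℓ) + (η / 2 * (2 * (n : ℝ) + 5) ^ 3 +
      z * (104 * (2 * (n : ℝ) + 5) ^ 2))) / (2 * ((n : ℝ) + 1)) ^ 3 = P (1 / ((n : ℝ) + 1)) := fun n => by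
    have hn : (n : ℝ) + 1 ≠ 0 := by positivity
    rw [hP]
    field_simp
    ring
  have hev : ∀ᶠ n : ℕ in atTop, klDiv (windowLaw (centredBox n) μ) (windowLaw (centredBox n) G) / volume (centredBox (d := Fin 3) n) ≤
      ENNReal.ofReal (σ ^ 3 * ℓ) + η := by
    filter_upwards [hF (η / 2) hδ, hPt.eventually_lt_const (by linarith : σ ^ 3 * ℓ + η / 2 < σ ^ 3 * ℓ + η)] with n hn hPlt
    have hv : (0 : ℝ) < (2 * ((n : ℝ) + 1)) ^ 3 := by positivity
    calc klDiv (windowLaw (centredBox n) μ) (windowLaw (centredBox n) G) / volume (centredBox (d := Fin 3) n)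
        ≤ ENNReal.ofReal (((2 * (n : ℝ) + 5) ^ 3 + η / 2) * (σ ^ 3 * ℓ) + (η / 2 * (2 * (n : ℝ) + 5) ^ 3 +
            z * (104 * (2 * (n : ℝ) + 5) ^ 2))) / ENNReal.ofReal ((2 * ((n : ℝ) + 1)) ^ 3) := by
          rw [volume_centredBox_fin3]; exact ENNReal.div_le_div_right hn _
      _ = ENNReal.ofReal (P (1 / ((n : ℝ) + 1))) := by rw [← ENNReal.ofReal_div_of_pos hv, hPn]
      _ ≤ ENNReal.ofReal (σ ^ 3 * ℓ + η) := ENNReal.ofReal_le_ofReal hPlt.le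
      _ ≤ ENNReal.ofReal (σ ^ 3 * ℓ) + ENNReal.ofReal η := ENNReal.ofReal_add_le
      _ = ENNReal.ofReal (σ ^ 3 * ℓ) + η := by rw [ENNReal.ofReal_coe_nnreal]
  exact limsup_le_of_le (by isBoundedDefault) hev

end Summit.AtomisticToContinuum.HydrodynamicLimit.Theorems.KiferCompactification

end
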